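import Mathlib
import Summits.ValiantsHypothesis.ValiantsHypothesis.Theorems.RigidityForcesSymmetryRankRigidMinimalReprLaplaceFiveSeparatedCaptureReduction
import Summits.ValiantsHypothesis.ValiantsHypothesis.Theorems.RigidityForcesSymmetryRankRigidMinimalReprLaplaceFiveSeparatedCaptureSpanTools

/-!
# ValiantsHypothesis / RigidityForcesSymmetry — crux `LaplaceOptimalFive` (stmt-ValiantsHypothesis-24813), symmetric capture:
# **ONE LINE TWICE AND A PLANE** (Case II of profile `(1,1,2)` of `CaptureIneqSym`): reduction to the prolongation of `V ⊔ ℂu`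

Case II (val-port-2 g5 ↔ crit-3 g8, 2026-08-29).  `U₀₁ = U₀₂ = ℂ·u` (`u` symmetric), `U₁₂ = V` symmetric.  Every obligation reads
`T(p,q,r) = u(p,q)a_r + u(p,r)b_q + C_p(q,r)`; with the MIDPOINT `a′ := (a + b)/2` the pencil identity `u(p,q)(a−b)_r = u(p,r)(a−b)_q`
(cf. ✓ `pencil_twoTerm`) gives, with NO case split on the rank of `u`, `T = P(u ⊗ a′) + G` with `G_p = C_p − a′_p·u`: `G` is fully
symmetric with slices in `V ⊔ ℂu` and the COUPLING `G_p + a′_p u ∈ V`.  Counting through the representation space `(a′, G)`: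
`finrank W ≤ finrank P + finrank K` for any `P ⊇` {symmetric tensors with slices in `V ⊔ ℂu`} (the prolongation, dimension `≤ 4`) and any
`K ⊇` {kernel vectors `a′`: `P(u ⊗ a′)` square-free, `a′_p u ∈ V`}; `K = ⊥` if `u ∉ V`; if `u ∈ V` a line, a plane, or the pair-monomial case.

* `equalPencil_midpoint` — `T − P(u ⊗ a′) = (C_p − a′_p u)_p` for `a′ = (a+b)/2`.
* ★ `finrank_le_of_equalPencil` — always `finrank W ≤ finrank P + finrank K` (`V` symmetric of any dimension).
* ★★ `finrank_le_of_equalPencil_of_not_mem` — `u ∉ V` ⇒ `finrank W ≤ finrank P`.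
* `exists_compl_of_mem` — `u ≠ 0` in `V`, `finrank V ≤ 2` ⇒ `V ⊂ span(u, v)`.
* ★ `finrank_le_three_of_monomial_pencil` — the pair-monomial sub-case `u = c·x_i x_j ∈ V`: `finrank W ≤ 3`.
* ★★ `finrank_le_of_equalPencil_of_mem` — `u ∈ V` (`finrank V ≤ 2`) ⇒ `finrank W ≤ 2 + finrank V` given `finrank P ≤ finrank V`:
  `u` with a non-zero diagonal entry ⇒ kernel line (`+1`); zero diagonal with three non-zero rows ⇒ kernel plane (`+2`); else the
  pair-monomial sub-case.

Honest framing.  Lemmas toward Case II; the prolongation bounds are ✓ `…SeparatedCaptureProlongation` (val-lit-p6 g18), consumed only by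
the assembly; the `(1,1,2)` assembly, `CaptureIneqSym` in general, K1, `LaplaceOptimalFive` (OPEN · CONTESTED 72/120) and
`VP ≠ VNP` are NOT proved here.  No definitions, no `sorry`.
-/

set_option linter.dupNamespace false
set_option autoImplicit false

namespace Summit.ValiantsHypothesis.ValiantsHypothesis.Theorems.RigidityForcesSymmetryRankRigidMinimalRepr

namespace LaplaceFiveSeparatedCapture

open Finset
section equalPencil

variable (u : Fin 5 → Fin 5 → ℂ) (hu : ∀ p q, u p q = u q p)

/-- **MIDPOINT FORM.**  For `T(p,q,r) = u(p,q)a_r + u(p,r)b_q + C_p(q,r)` symmetric in the slots `(1 2)` (with symmetric `C_p`), and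
`a′ := (a + b)/2`: `T − P(u ⊗ a′)` has `p`-slice `C_p − a′_p·u`.  (The pencil identity for `u₁ = u₂ = u`; no case split on the rank
of `u`.) [folklore] -/
theorem equalPencil_midpoint (C : Fin 5 → Fin 5 → Fin 5 → ℂ) (hC : ∀ p q r, C p q r = C p r q)
    (T : Fin 5 → Fin 5 → Fin 5 → ℂ) (a b : Fin 5 → ℂ)
    (hT : ∀ p q r, T p q r = u p q * a r + u p r * b q + C p q r) (h23 : ∀ p q r, T p q r = T p r q) (p q r : Fin 5) :
    T p q r - (u p q * ((a r + b r) / 2) + u p r * ((a q + b q) / 2) + u q r * ((a p + b p) / 2))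
      = C p q r - (a p + b p) / 2 * u q r := by
  -- the two-term (pencil) identity `u(p,q)(a−b)_r = u(p,r)(a−b)_q` from the `(1 2)` slot symmetry (cf. ✓ `pencil_twoTerm`)
  have h := h23 p q r
  rw [hT, hT, hC p r q] at h
  rw [hT]
  linear_combination (1 / 2 : ℂ) * h

include hu

/-- ★ **THE GENERAL COUNT.**  `U₀₁ = U₀₂ = ℂ·u`, `U₁₂ = V` symmetric of dimension `≤ 2`.  For ANY submodule `P` containing every
`(0 1)`,`(1 2)`-symmetric tensor with all slices in `V ⊔ ℂu`, and ANY submodule `K ⊂ ℂ⁵` containing every `a` whose symmetrised placement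
`P(u ⊗ a)` vanishes at repeated letters and with `a_p u ∈ V` for all `p`: `finrank W ≤ finrank P + finrank K`.  (`V` symmetric of ANY
dimension.) [folklore] -/
theorem finrank_le_of_equalPencil (V W : Submodule ℂ (Fin 5 → Fin 5 → ℂ))
    (hV : ∀ x ∈ V, ∀ p q : Fin 5, x p q = x q p)
    (hWs : ∀ μ ∈ W, ∀ s t : Fin 5, μ s t = μ t s) (hWd : ∀ μ ∈ W, ∀ s : Fin 5, μ s s = 0)
    (hWc : ∀ μ ∈ W, contractZ μ ∈ L3 (ℂ ∙ u) (ℂ ∙ u) V)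
    (P : Submodule ℂ (Fin 5 → Fin 5 → Fin 5 → ℂ))
    (hP : ∀ G : Fin 5 → Fin 5 → Fin 5 → ℂ, (∀ p q r, G p q r = G q p r) → (∀ p q r, G p q r = G p r q) →
      (∀ p, G p ∈ V ⊔ (ℂ ∙ u)) → G ∈ P)
    (K : Submodule ℂ (Fin 5 → ℂ))
    (hK : ∀ a : Fin 5 → ℂ, (∀ p r, u p p * a r + 2 * (u p r * a p) = 0) → (∀ p, a p • u ∈ V) → a ∈ K) :
    Module.finrank ℂ W ≤ Module.finrank ℂ P + Module.finrank ℂ K := by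
  classical
  -- representation space `X ∋ (a′, G)`, assembly `Φ(a′, G) = P(u ⊗ a′) + G`, projections `π = snd`, `ρ = fst`
  let X := (Fin 5 → ℂ) × (Fin 5 → Fin 5 → Fin 5 → ℂ)
  let Su : (Fin 5 → ℂ) →ₗ[ℂ] (Fin 5 → Fin 5 → Fin 5 → ℂ) :=
    { toFun := fun a p q r => u p q * a r + u p r * a q + u q r * a p
      map_add' := fun x y => by funext p q r; simp only [Pi.add_apply]; ring
      map_smul' := fun s x => by funext p q r; simp only [Pi.smul_apply, smul_eq_mul, RingHom.id_apply]; ring }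
  have hSu : ∀ (a : Fin 5 → ℂ) p q r, Su a p q r = u p q * a r + u p r * a q + u q r * a p := fun a p q r => rfl
  let Φ : X →ₗ[ℂ] (Fin 5 → Fin 5 → Fin 5 → ℂ) := Su.comp (LinearMap.fst ℂ _ _) + LinearMap.snd ℂ _ _
  let π : X →ₗ[ℂ] (Fin 5 → Fin 5 → Fin 5 → ℂ) := LinearMap.snd ℂ _ _
  let ρ : X →ₗ[ℂ] (Fin 5 → ℂ) := LinearMap.fst ℂ _ _
  have hΦ : ∀ x : X, Φ x = Su x.1 + x.2 := fun x => rfl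
  have hπ : ∀ x : X, π x = x.2 := fun x => rfl
  have hρ' : ∀ x : X, ρ x = x.1 := fun x => rfl
  -- coupling `G_p + a′_p u ∈ V`
  let Lp : Fin 5 → (X →ₗ[ℂ] (Fin 5 → Fin 5 → ℂ)) := fun p =>
    (LinearMap.proj p : (Fin 5 → Fin 5 → Fin 5 → ℂ) →ₗ[ℂ] (Fin 5 → Fin 5 → ℂ)).comp
        (LinearMap.snd ℂ (Fin 5 → ℂ) (Fin 5 → Fin 5 → Fin 5 → ℂ)) +
      ((LinearMap.proj p : (Fin 5 → ℂ) →ₗ[ℂ] ℂ).smulRight u).comp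
        (LinearMap.fst ℂ (Fin 5 → ℂ) (Fin 5 → Fin 5 → Fin 5 → ℂ))
  have hLp : ∀ (x : X) p, Lp p x = x.2 p + x.1 p • u := fun x p => rfl
  let Cpl : Submodule ℂ X := ⨅ p : Fin 5, V.comap (Lp p)
  have hCpl : ∀ x : X, x ∈ Cpl ↔ ∀ p, x.2 p + x.1 p • u ∈ V := fun x => by
    simp only [Cpl, Submodule.mem_iInf, Submodule.mem_comap, hLp]
  let R : Submodule ℂ X := ((W.map cZ).comap Φ ⊓ P.comap π) ⊓ Cpl
  -- `ρ` is injective on `R ⊓ ker π`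
  have hρ : ∀ x ∈ R, π x = 0 → ρ x = 0 → x = 0 := by
    intro x _ hπ0 hρ0
    rw [hπ] at hπ0; rw [hρ'] at hρ0
    exact Prod.ext hρ0 hπ0
  -- every obligation lies in `Φ(R)`
  have hmem : ∀ μ ∈ W, contractZ μ ∈ R.map Φ := by
    intro μ hμ
    obtain ⟨a, b, C, hC, hT⟩ := vectors_form_of_mem_L3 u u V (hWc μ hμ)
    let a' : Fin 5 → ℂ := fun p => (a p + b p) / 2
    let G : Fin 5 → Fin 5 → Fin 5 → ℂ := fun p q r => C p q r - a' p * u q r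
    have hCs : ∀ p q r, C p q r = C p r q := fun p q r => hV _ (hC p) q r
    have hTG : ∀ p q r, contractZ μ p q r = Su a' p q r + G p q r := by
      intro p q r
      have h := equalPencil_midpoint u C hCs (contractZ μ) a b hT (fun p q r => (contractZ_swap23 μ p q r).symm) p q r
      rw [hSu]
      show contractZ μ p q r = u p q * ((a r + b r) / 2) + u p r * ((a q + b q) / 2) + u q r * ((a p + b p) / 2)
        + (C p q r - (a p + b p) / 2 * u q r)
      linear_combination h
    have hS12 : ∀ p q r, Su a' p q r = Su a' q p r := fun p q r => by rw [hSu, hSu, hu p q, hu q r, hu p r]; ring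
    have hS23 : ∀ p q r, Su a' p q r = Su a' p r q := fun p q r => by rw [hSu, hSu, hu q r]; ring
    have hG12 : ∀ p q r, G p q r = G q p r := fun p q r => by
      have h1 := hTG p q r; have h2 := hTG q p r
      have h3 := contractZ_swap12 μ p q r
      rw [hS12 q p r] at h2
      linear_combination h2 - h1 - h3
    have hG23 : ∀ p q r, G p q r = G p r q := fun p q r => by
      have h1 := hTG p q r; have h2 := hTG p r q
      have h3 := contractZ_swap23 μ p q r
      rw [hS23 p r q] at h2
      linear_combination h2 - h1 - h3
    have hGp : ∀ p, G p = C p - a' p • u := fun p => by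
      funext q r; simp only [G, Pi.sub_apply, Pi.smul_apply, smul_eq_mul]
    have hGX : ∀ p, G p ∈ V ⊔ (ℂ ∙ u) := fun p => by
      rw [hGp]
      exact Submodule.sub_mem _ (Submodule.mem_sup_left (hC p))
        (Submodule.mem_sup_right (Submodule.smul_mem _ _ (Submodule.mem_span_singleton_self u)))
    refine Submodule.mem_map.mpr ⟨(a', G), ?_, ?_⟩
    · refine Submodule.mem_inf.mpr ⟨Submodule.mem_inf.mpr ⟨?_, ?_⟩, (hCpl _).mpr fun p => ?_⟩
      · rw [Submodule.mem_comap]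
        refine Submodule.mem_map.mpr ⟨μ, hμ, ?_⟩
        rw [cZ_apply]; funext p q r
        show contractZ μ p q r = Su a' p q r + G p q r
        exact hTG p q r
      · rw [Submodule.mem_comap]
        show G ∈ P
        exact hP G hG12 hG23 hGX
      · show G p + a' p • u ∈ V
        rw [hGp, sub_add_cancel]; exact hC p
    · funext p q r
      show Su a' p q r + G p q r = contractZ μ p q r
      exact (hTG p q r).symm
  -- `W ↪ Φ(R)`
  let f : W →ₗ[ℂ] (R.map Φ) := LinearMap.codRestrict (R.map Φ) (cZ.domRestrict W) (fun μ => by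
    simpa [cZ_apply] using hmem μ.1 μ.2)
  have hf : Function.Injective f := by
    rw [injective_iff_map_eq_zero]
    intro μ hμ
    have hT : contractZ μ.1 = 0 := by
      have := congrArg Subtype.val hμ
      simpa [f, cZ_apply] using this
    apply Subtype.ext
    refine hub_injective μ.1 (hWs μ.1 μ.2) (hWd μ.1 μ.2) fun p q => ?_
    simp [hT]
  have h1 := LinearMap.finrank_le_finrank_of_injective hf
  have h2' := finrank_map_le_add Φ π ρ R hρ
  have h3 : Module.finrank ℂ (R.map π) ≤ Module.finrank ℂ P :=
    Submodule.finrank_mono (Submodule.map_le_iff_le_comap.mpr (le_trans inf_le_left inf_le_right))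
  -- the kernel part: `a′` with `P(u ⊗ a′)` an obligation, hence square-free
  have h4 : Module.finrank ℂ ((R ⊓ LinearMap.ker π).map ρ) ≤ Module.finrank ℂ K := by
    refine Submodule.finrank_mono ?_
    rintro a ha
    obtain ⟨x, hx, rfl⟩ := Submodule.mem_map.mp ha
    obtain ⟨hxR, hxk⟩ := Submodule.mem_inf.mp hx
    have hx2 : x.2 = 0 := by have := LinearMap.mem_ker.mp hxk; rwa [hπ] at this
    have hxW : Φ x ∈ W.map cZ := Submodule.mem_comap.mp (Submodule.mem_inf.mp (Submodule.mem_inf.mp hxR).1).1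
    obtain ⟨μ, -, hμ⟩ := Submodule.mem_map.mp hxW
    rw [cZ_apply, hΦ, hx2, add_zero] at hμ
    have hxC : ∀ p, x.2 p + x.1 p • u ∈ V := (hCpl x).mp (Submodule.mem_inf.mp hxR).2
    rw [hρ']
    refine hK x.1 (fun p r => ?_) (fun p => ?_)
    · have h0 := contractZ_rep12 μ p r
      rw [hμ, hSu] at h0
      linear_combination h0
    · have := hxC p
      rwa [hx2, Pi.zero_apply, zero_add] at this
  omega

/-- ★★ **CASE II WITH `u ∉ V`: `finrank W ≤ finrank P`** for any submodule `P` containing the `(0 1)`,`(1 2)`-symmetric tensors with all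
slices in `V ⊔ ℂu` (e.g. the prolongation `(V ⊔ ℂu)⁽¹⁾`, of dimension `≤ 4`). [folklore] -/
theorem finrank_le_of_equalPencil_of_not_mem (V W : Submodule ℂ (Fin 5 → Fin 5 → ℂ))
    (hV : ∀ x ∈ V, ∀ p q : Fin 5, x p q = x q p) (huV : u ∉ V)
    (hWs : ∀ μ ∈ W, ∀ s t : Fin 5, μ s t = μ t s) (hWd : ∀ μ ∈ W, ∀ s : Fin 5, μ s s = 0)
    (hWc : ∀ μ ∈ W, contractZ μ ∈ L3 (ℂ ∙ u) (ℂ ∙ u) V)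
    (P : Submodule ℂ (Fin 5 → Fin 5 → Fin 5 → ℂ))
    (hP : ∀ G : Fin 5 → Fin 5 → Fin 5 → ℂ, (∀ p q r, G p q r = G q p r) → (∀ p q r, G p q r = G p r q) →
      (∀ p, G p ∈ V ⊔ (ℂ ∙ u)) → G ∈ P) :
    Module.finrank ℂ W ≤ Module.finrank ℂ P := by
  have h := finrank_le_of_equalPencil u hu V W hV hWs hWd hWc P hP ⊥ (fun a _ ha => by
    rw [Submodule.mem_bot]
    funext p
    by_contra hp
    apply huV
    have : u = (a p)⁻¹ • (a p • u) := by rw [smul_smul, inv_mul_cancel₀ hp, one_smul]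
    rw [this]
    exact V.smul_mem _ (ha p))
  rw [finrank_bot, add_zero] at h
  exact h

end equalPencil
/-! ### The case `u ∈ V` -/

/-- If `u ≠ 0` lies in a space `V` of symmetric matrices of dimension `≤ 2`, then `V ⊂ span(u, v)` for some `v`. [folklore] -/
theorem exists_compl_of_mem (V : Submodule ℂ (Fin 5 → Fin 5 → ℂ)) (hV : ∀ x ∈ V, ∀ p q : Fin 5, x p q = x q p)
    (h2 : Module.finrank ℂ V ≤ 2) (u : Fin 5 → Fin 5 → ℂ) (huV : u ∈ V) (hu0 : u ≠ 0) :
    ∃ v : Fin 5 → Fin 5 → ℂ, ∀ x ∈ V, ∃ α β : ℂ, x = α • u + β • v := by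
  obtain ⟨v₁, v₂, -, -, hsp⟩ := exists_pair_of_finrank_le_two V hV h2
  obtain ⟨α₀, β₀, hu⟩ := hsp u huV
  by_cases hα : α₀ = 0
  · rw [hα, zero_smul, zero_add] at hu
    have hβ : β₀ ≠ 0 := by rintro rfl; exact hu0 (by rw [hu, zero_smul])
    refine ⟨v₁, fun x hx => ?_⟩
    obtain ⟨γ, δ, hx⟩ := hsp x hx
    refine ⟨δ / β₀, γ, ?_⟩
    rw [hx, hu, smul_smul, div_mul_cancel₀ _ hβ, add_comm]
  · refine ⟨v₂, fun x hx => ?_⟩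
    obtain ⟨γ, δ, hx⟩ := hsp x hx
    refine ⟨γ / α₀, δ - γ / α₀ * β₀, ?_⟩
    have hv₁ : v₁ = α₀⁻¹ • (u - β₀ • v₂) := by
      rw [hu, add_sub_cancel_right, smul_smul, inv_mul_cancel₀ hα, one_smul]
    rw [hx, hv₁]
    module

/-- ★ **THE MONOMIAL SUB-CASE `u = c·x_i x_j ∈ V`: `finrank W ≤ 3`.**  If all rows of `u` except `i ≠ j` vanish (so `u` is a multiple
of the pair indicator `x_i x_j` when symmetric with zero diagonal) and `V ⊂ span(u, v)`, then every obligation of `L3 (ℂu) (ℂu) V` is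
supported on the words `{i, j, k}`: the slices at letters `p ∉ {i,j}` are `C_p ∈ V` and the repeated-letter vanishing kills them off
`{i,j}` (`vanish_of_offpair_support`); so `μ ↦ (k ↦ T_μ(i,j,k))` is injective with values supported off `{i, j}`. [folklore] -/
theorem finrank_le_three_of_monomial_pencil (u : Fin 5 → Fin 5 → ℂ)
    (i j : Fin 5) (hij : i ≠ j) (hrow : ∀ p, p ≠ i → p ≠ j → ∀ q, u p q = 0)
    (V W : Submodule ℂ (Fin 5 → Fin 5 → ℂ)) (v : Fin 5 → Fin 5 → ℂ) (hVsp : ∀ x ∈ V, ∃ α β : ℂ, x = α • u + β • v)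
    (hWs : ∀ μ ∈ W, ∀ s t : Fin 5, μ s t = μ t s) (hWd : ∀ μ ∈ W, ∀ s : Fin 5, μ s s = 0)
    (hWc : ∀ μ ∈ W, contractZ μ ∈ L3 (ℂ ∙ u) (ℂ ∙ u) V) :
    Module.finrank ℂ W ≤ 3 := by
  classical
  have hS12 : ∀ μ (p q r : Fin 5), contractZ μ p q r = contractZ μ q p r := fun μ p q r => (contractZ_swap12 μ p q r).symm
  have hS23 : ∀ μ (p q r : Fin 5), contractZ μ p q r = contractZ μ p r q := fun μ p q r => (contractZ_swap23 μ p q r).symm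
  -- support: `T(p,q,r) = 0` as soon as `p, q ∉ {i, j}` (only the vanishing ROWS of `u` at letters off `{i,j}` are used)
  have hsupp : ∀ μ ∈ W, ∀ p q r, p ≠ i → p ≠ j → q ≠ i → q ≠ j → contractZ μ p q r = 0 := by
    intro μ hμ p q r hpi hpj hqi hqj
    obtain ⟨a, b, C, hC, hT⟩ := vectors_form_of_mem_L3 u u V (hWc μ hμ)
    have hsl : ∀ p', p' ≠ i → p' ≠ j → ∀ s r', contractZ μ p' s r' = C p' s r' := by
      intro p' h1 h2 s r'; rw [hT, hrow p' h1 h2 s, hrow p' h1 h2 r']; ring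
    obtain ⟨αp, βp, hCp⟩ := hVsp _ (hC p)
    obtain ⟨αq, βq, hCq⟩ := hVsp _ (hC q)
    have hCp' : ∀ s r', C p s r' = αp * u s r' + βp * v s r' := fun s r' => by
      rw [hCp]; simp only [Pi.add_apply, Pi.smul_apply, smul_eq_mul]
    have hCq' : ∀ s r', C q s r' = αq * u s r' + βq * v s r' := fun s r' => by
      rw [hCq]; simp only [Pi.add_apply, Pi.smul_apply, smul_eq_mul]
    have hβp : ∀ r', βp * v p r' = 0 := by
      intro r'
      have h := contractZ_rep12 μ p r'
      rw [hsl p hpi hpj, hCp', hrow p hpi hpj r'] at h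
      linear_combination h
    by_cases hpq : p = q
    · subst hpq; exact contractZ_rep12 μ p r
    have e1 : contractZ μ p q r = βp * v q r := by rw [hsl p hpi hpj, hCp', hrow q hqi hqj r]; ring
    have e2 : contractZ μ p q r = βq * v p r := by rw [hS12, hsl q hqi hqj, hCq', hrow p hpi hpj r]; ring
    by_cases hb : βp = 0
    · rw [e1, hb, zero_mul]
    · have hv : v p r = 0 := by
        rcases mul_eq_zero.mp (hβp r) with h | h
        · exact absurd h hb
        · exact h
      rw [e2, hv, mul_zero]
  -- the reading map `μ ↦ (k ↦ T_μ(i,j,k))`, injective, with values supported off `{i, j}`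
  let S : Finset (Fin 5) := (Finset.univ.erase i).erase j
  let Y : Submodule ℂ (Fin 5 → ℂ) :=
    Submodule.span ℂ (↑(S.image fun k : Fin 5 => fun j : Fin 5 => if k = j then (1 : ℂ) else 0) : Set (Fin 5 → ℂ))
  have hSc : S.card = 3 := by
    have hj : j ∈ Finset.univ.erase i := Finset.mem_erase.mpr ⟨hij.symm, Finset.mem_univ j⟩
    simp only [S, Finset.card_erase_of_mem hj, Finset.card_erase_of_mem (Finset.mem_univ i), Finset.card_univ,
      Fintype.card_fin]
  let ev : (Fin 5 → Fin 5 → Fin 5 → ℂ) →ₗ[ℂ] (Fin 5 → ℂ) :=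
    (LinearMap.proj j : (Fin 5 → Fin 5 → ℂ) →ₗ[ℂ] (Fin 5 → ℂ)).comp
      (LinearMap.proj i : (Fin 5 → Fin 5 → Fin 5 → ℂ) →ₗ[ℂ] (Fin 5 → Fin 5 → ℂ))
  have hev : ∀ G : Fin 5 → Fin 5 → Fin 5 → ℂ, ev G = G i j := fun G => rfl
  have hmem : ∀ μ ∈ W, ev (contractZ μ) ∈ Y := by
    intro μ hμ
    rw [hev]
    refine mem_span_indicators _ S fun k hk => ?_
    have hk' : k = i ∨ k = j := by
      by_contra h
      push Not at h
      exact hk (Finset.mem_erase.mpr ⟨h.2, Finset.mem_erase.mpr ⟨h.1, Finset.mem_univ k⟩⟩)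
    rcases hk' with rfl | rfl
    · show contractZ μ k j k = 0
      rw [hS23]; exact contractZ_rep12 μ k j
    · show contractZ μ i k k = 0
      rw [hS12, hS23]; exact contractZ_rep12 μ k i
  let f : W →ₗ[ℂ] Y := LinearMap.codRestrict Y ((ev.comp cZ).domRestrict W) (fun μ => by
    simpa [cZ_apply] using hmem μ.1 μ.2)
  have hf : Function.Injective f := by
    rw [injective_iff_map_eq_zero]
    intro μ hμ
    have h0 : ∀ k, contractZ μ.1 i j k = 0 := by
      intro k
      have := congrArg Subtype.val hμ
      have h' : ev (contractZ μ.1) = 0 := by simpa [f, cZ_apply] using this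
      have := congrFun h' k
      rwa [hev] at this
    have hT : ∀ p q r, contractZ μ.1 p q r = 0 :=
      vanish_of_offpair_support (contractZ μ.1) (hS12 μ.1) (hS23 μ.1) (contractZ_rep12 μ.1) i j h0
        (hsupp μ.1 μ.2)
    apply Subtype.ext
    refine hub_injective μ.1 (hWs μ.1 μ.2) (hWd μ.1 μ.2) fun p q => ?_
    simp [hT]
  have h1 := LinearMap.finrank_le_finrank_of_injective hf
  have h2 : Module.finrank ℂ Y ≤ 3 := (finrank_span_indicators_le S).trans hSc.le
  omega

/-- ★★ **CASE II WITH `u ∈ V`: `finrank W ≤ 2 + finrank V`** given a submodule `P ⊇` {symmetric tensors with slices in `V ⊔ ℂu`} with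
`finrank P ≤ finrank V` (the prolongation `V⁽¹⁾`, `finrank V ≤ 2`).  Split: `u` has a non-zero diagonal entry (kernel line, `+1`);
zero diagonal with three non-zero rows (kernel plane, `+2`); else `u` is a pair monomial (`finrank_le_three_of_monomial_pencil`). [folklore] -/
theorem finrank_le_of_equalPencil_of_mem (u : Fin 5 → Fin 5 → ℂ) (hu : ∀ p q, u p q = u q p) (hu0 : u ≠ 0)
    (V W : Submodule ℂ (Fin 5 → Fin 5 → ℂ))
    (hV : ∀ x ∈ V, ∀ p q : Fin 5, x p q = x q p) (h2 : Module.finrank ℂ V ≤ 2) (huV : u ∈ V)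
    (hWs : ∀ μ ∈ W, ∀ s t : Fin 5, μ s t = μ t s) (hWd : ∀ μ ∈ W, ∀ s : Fin 5, μ s s = 0)
    (hWc : ∀ μ ∈ W, contractZ μ ∈ L3 (ℂ ∙ u) (ℂ ∙ u) V)
    (P : Submodule ℂ (Fin 5 → Fin 5 → Fin 5 → ℂ))
    (hP : ∀ G : Fin 5 → Fin 5 → Fin 5 → ℂ, (∀ p q r, G p q r = G q p r) → (∀ p q r, G p q r = G p r q) →
      (∀ p, G p ∈ V ⊔ (ℂ ∙ u)) → G ∈ P)
    (hPV : Module.finrank ℂ P ≤ Module.finrank ℂ V) :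
    Module.finrank ℂ W ≤ 2 + Module.finrank ℂ V := by
  classical
  by_cases hdiag : ∃ p₀, u p₀ p₀ ≠ 0
  · -- the kernel vectors lie on the line through `d`
    obtain ⟨p₀, hp₀⟩ := hdiag
    let d : Fin 5 → ℂ := fun r => -(2 * u p₀ r) / u p₀ p₀
    have h := finrank_le_of_equalPencil u hu V W hV hWs hWd hWc P hP (ℂ ∙ d) (fun a ha _ => by
      refine Submodule.mem_span_singleton.mpr ⟨a p₀, funext fun r => ?_⟩
      simp only [Pi.smul_apply, smul_eq_mul, d]
      have := ha p₀ r
      field_simp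
      linear_combination -this)
    have h1 : Module.finrank ℂ (ℂ ∙ d) ≤ 1 := by
      have := finrank_span_le_card (R := ℂ) ({d} : Set (Fin 5 → ℂ))
      simpa using this
    omega
  push Not at hdiag
  -- zero diagonal: pick a non-zero entry `u i j`, `i ≠ j`
  have hne : ∃ i j, u i j ≠ 0 := by
    by_contra h
    push Not at h
    exact hu0 (funext fun p => funext fun q => h p q)
  obtain ⟨i, j, hij0⟩ := hne
  have hij : i ≠ j := by rintro rfl; exact hij0 (hdiag i)
  by_cases h3 : ∃ p, p ≠ i ∧ p ≠ j ∧ ∃ q, u p q ≠ 0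
  · -- three non-zero rows `i, j, p`: the kernel vectors are supported off `{i, j, p}`
    obtain ⟨p, hpi, hpj, q, hpq⟩ := h3
    let S : Finset (Fin 5) := ((Finset.univ.erase i).erase j).erase p
    have hSc : S.card = 2 := by
      have hj : j ∈ Finset.univ.erase i := Finset.mem_erase.mpr ⟨hij.symm, Finset.mem_univ j⟩
      have hp : p ∈ (Finset.univ.erase i).erase j :=
        Finset.mem_erase.mpr ⟨hpj, Finset.mem_erase.mpr ⟨hpi, Finset.mem_univ p⟩⟩
      simp only [S, Finset.card_erase_of_mem hp, Finset.card_erase_of_mem hj, Finset.card_erase_of_mem (Finset.mem_univ i),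
        Finset.card_univ, Fintype.card_fin]
    have h := finrank_le_of_equalPencil u hu V W hV hWs hWd hWc P hP
      (Submodule.span ℂ (↑(S.image fun k : Fin 5 => fun j : Fin 5 => if k = j then (1 : ℂ) else 0) : Set (Fin 5 → ℂ)))
      (fun a ha _ => by
        -- `a_m = 0` for every letter `m` with a non-zero row
        have hz : ∀ m r, u m r ≠ 0 → a m = 0 := by
          intro m r hmr
          have h := ha m r
          rw [hdiag m, zero_mul, zero_add] at h
          rcases mul_eq_zero.mp h with h' | h'
          · norm_num at h'
          · rcases mul_eq_zero.mp h' with h'' | h''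
            · exact absurd h'' hmr
            · exact h''
        refine mem_span_indicators a S fun k hk => ?_
        by_cases hki : k = i
        · rw [hki]; exact hz i j hij0
        by_cases hkj : k = j
        · rw [hkj]; exact hz j i (by rw [hu]; exact hij0)
        by_cases hkp : k = p
        · rw [hkp]; exact hz p q hpq
        exact absurd (Finset.mem_erase.mpr ⟨hkp, Finset.mem_erase.mpr ⟨hkj, Finset.mem_erase.mpr
          ⟨hki, Finset.mem_univ k⟩⟩⟩) hk)
    have h1 := (finrank_span_indicators_le S).trans hSc.le
    omega
  · push Not at h3
    have hrow : ∀ p, p ≠ i → p ≠ j → ∀ q, u p q = 0 := fun p h1 h2 q => h3 p h1 h2 q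
    obtain ⟨v, hVsp⟩ := exists_compl_of_mem V hV h2 u huV hu0
    have h := finrank_le_three_of_monomial_pencil u i j hij hrow V W v hVsp hWs hWd hWc
    have hV1 : 1 ≤ Module.finrank ℂ V := by
      rw [← finrank_span_singleton (K := ℂ) hu0]
      exact Submodule.finrank_mono ((Submodule.span_singleton_le_iff_mem u V).mpr huV)
    omega

end LaplaceFiveSeparatedCapture

end Summit.ValiantsHypothesis.ValiantsHypothesis.Theorems.RigidityForcesSymmetryRankRigidMinimalRepr
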